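import Mathlib.Analysis.Matrix.Spectrum
import Mathlib.Analysis.Matrix.PosDef
import Mathlib.Analysis.Calculus.ContDiff.Operations
import Mathlib.Analysis.SpecialFunctions.Sqrt
import HarnessLib

/-!
# Smooth sums of squares: a symmetric matrix field near a positive definite matrix is
# `∑ⱼ gⱼ(p)² wⱼ wⱼᵀ` with constant vectors `wⱼ` and smooth functions `gⱼ`

Analysis/Distribution support file (serves the discharge of the named fact
`Literature.Geometry.Riemannian.perelman_noLocalCollapsing` through the linear heat equation on
closed manifolds: to apply Hörmander's hypoellipticity theorem for sums of squares of vector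
fields, `Literature.Analysis.Distribution.Hormander1967_thm11` — PROVED in this tree as
`Literature.Analysis.Hypoelliptic.hormander1967_thm11_proof` — to the heat operator
`∂ₛ − Δ_{h(s)}` in a chart, its principal part `∑ₖₗ aₖₗ(p) ∂ₖ∂ₗ` must be written as a sum of
squares `∑ⱼ Yⱼ²` of SMOOTH vector fields; `Yⱼ = gⱼ(p) wⱼ` with the data of this file does it).

Elementary linear algebra (no source needed beyond the spectral theorem): if `A₀ = (aₖₗ)` is a
real symmetric positive definite `κ × κ` matrix with orthonormal eigenbasis `(u_a)` and
eigenvalues `λ_a > 0`, then every symmetric matrix `A` expands as `A = ∑_{ab} B_{ab} u_a u_bᵀ`,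
`B_{ab} = u_aᵀ A u_b`, and for any constant `c₀`

  `A = ∑_a (B_{aa} − 2c₀(n−1)) u_a u_aᵀ`
      `+ ∑_{a ≠ b} [ (c₀ + B_{ab}/2)/2 · (u_a + u_b)(u_a + u_b)ᵀ + (c₀ − B_{ab}/2)/2 · (u_a − u_b)(u_a − u_b)ᵀ ]`

(`n = card κ`; an exact polynomial identity, `sos_sum_identity`). If `A = A(p)` depends smoothly
on a parameter and stays entrywise `δ`-close to `A₀`, `δ = δ(A₀) > 0`, then with
`c₀ = λ_min/(2n)` all the coefficients are smooth functions of `p` which are either everywhere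
positive or identically zero, so their square roots `gⱼ` are smooth:
`exists_smooth_sumOfSquares`. The vectors of the first family are the `u_a`, which span.

Everything is proved; no definitions besides the index bookkeeping inside proofs, no named facts.

## References

* L. Hörmander, *Hypoelliptic second order differential equations*, Acta Math. 119 (1967)
  147–171, (1.6) and Thm 1.1 (the class `∑ Xⱼ² + X₀ + c`). [Hormander1967]
-/

noncomputable section

open Finset Matrix
open scoped ContDiff InnerProductSpace

namespace Literature.Analysis.Distribution

variable {κ : Type*} [Fintype κ] [DecidableEq κ]

/-! ### The polynomial identities -/

/-- The contribution of one ordered pair: `(c+β)/2·(x+y)(x'+y') + (c−β)/2·(x−y)(x'−y')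
= c(xx' + yy') + β(xy' + yx')`. [folklore] -/
theorem sos_pair_identity (c β x y x' y' : ℝ) :
    (c + β) / 2 * ((x + y) * (x' + y')) + (c - β) / 2 * ((x - y) * (x' - y')) =
      c * (x * x' + y * y') + β * (x * y' + y * x') := by
  ring

/-- **Expansion in a complete system.** If `∑_a u_a(k) u_a(l) = δ_{kl}` (the `u_a` are the rows
of an orthogonal matrix), then `A_{kl} = ∑_{ab} (u_aᵀ A u_b) u_a(k) u_b(l)` for every matrix `A`.
[folklore] -/
theorem sos_expand_of_complete {u : κ → κ → ℝ}
    (hcomp : ∀ k l, ∑ a, u a k * u a l = if k = l then 1 else 0) (A : κ → κ → ℝ) (k l : κ) :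
    A k l = ∑ a, ∑ b, (∑ k', ∑ l', u a k' * A k' l' * u b l') * (u a k * u b l) := by
  -- expand and reorder the sums
  set F : κ → κ → κ → κ → ℝ := fun a b k' l' ↦ A k' l' * ((u a k' * u a k) * (u b l' * u b l))
    with hF
  have h1 : ∀ a b, (∑ k', ∑ l', u a k' * A k' l' * u b l') * (u a k * u b l) =
      ∑ k', ∑ l', F a b k' l' := by
    intro a b
    rw [Finset.sum_mul]
    refine Finset.sum_congr rfl fun k' _ ↦ ?_
    rw [Finset.sum_mul]
    refine Finset.sum_congr rfl fun l' _ ↦ ?_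
    simp only [hF]; ring
  simp_rw [h1]
  have step1 : ∀ a, ∑ b, ∑ k', ∑ l', F a b k' l' = ∑ k', ∑ l', ∑ b, F a b k' l' := by
    intro a
    rw [Finset.sum_comm]
    refine Finset.sum_congr rfl fun k' _ ↦ ?_
    rw [Finset.sum_comm]
  simp_rw [step1]
  rw [Finset.sum_comm]
  have step2 : ∀ k', ∑ a, ∑ l', ∑ b, F a b k' l' = ∑ l', ∑ a, ∑ b, F a b k' l' := by
    intro k'
    rw [Finset.sum_comm]
  simp_rw [step2]
  -- evaluate the inner double sum with completeness
  have h2 : ∀ k' l', ∑ a, ∑ b, F a b k' l' =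
      A k' l' * ((if k' = k then 1 else 0) * (if l' = l then 1 else 0)) := by
    intro k' l'
    rw [← hcomp k' k, ← hcomp l' l, Finset.sum_mul_sum, Finset.mul_sum]
    refine Finset.sum_congr rfl fun a _ ↦ ?_
    rw [Finset.mul_sum]
  simp_rw [h2]
  simp [mul_ite, Finset.sum_ite_eq', Finset.mem_univ]

/-- **The sum-of-squares identity.** For symmetric `B`, any `c₀` and any family `u`, with
`n = card κ` and `S_{kl} = ∑_a u_a(k) u_a(l)`:
`∑_a (B_{aa} − 2c₀(n−1)) u_a(k)u_a(l) + ∑_{a≠b} [ (c₀+B_{ab}/2)/2 (u_a+u_b)(k)(u_a+u_b)(l)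
 + (c₀−B_{ab}/2)/2 (u_a−u_b)(k)(u_a−u_b)(l) ] = ∑_{ab} B_{ab} u_a(k) u_b(l)`. [folklore] -/
theorem sos_sum_identity (u : κ → κ → ℝ) {B : κ → κ → ℝ} (hB : ∀ a b, B a b = B b a)
    (c₀ : ℝ) (k l : κ) :
    (∑ a, (B a a - 2 * c₀ * (Fintype.card κ - 1)) * (u a k * u a l)) +
      ∑ a, ∑ b, (if a = b then 0 else
        ((c₀ + B a b / 2) / 2 * ((u a k + u b k) * (u a l + u b l)) +
          (c₀ - B a b / 2) / 2 * ((u a k - u b k) * (u a l - u b l)))) =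
      ∑ a, ∑ b, B a b * (u a k * u b l) := by
  -- the pair terms, with the diagonal put back
  set F : κ → κ → ℝ := fun a b ↦ (c₀ + B a b / 2) / 2 * ((u a k + u b k) * (u a l + u b l)) +
    (c₀ - B a b / 2) / 2 * ((u a k - u b k) * (u a l - u b l)) with hF
  set S : ℝ := ∑ a, u a k * u a l with hS
  have hFab : ∀ a b, F a b = c₀ * (u a k * u a l + u b k * u b l) +
      B a b / 2 * (u a k * u b l + u b k * u a l) := fun a b ↦ sos_pair_identity _ _ _ _ _ _
  have hFaa : ∀ a, F a a = 2 * c₀ * (u a k * u a l) + B a a * (u a k * u a l) := by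
    intro a; rw [hFab]; ring
  -- `∑_{ab} F a b = 2 c₀ n S + ∑_{ab} B_{ab} u_a(k) u_b(l)`
  have hsumF : ∑ a, ∑ b, F a b = 2 * c₀ * (Fintype.card κ) * S + ∑ a, ∑ b, B a b * (u a k * u b l) := by
    simp_rw [hFab, Finset.sum_add_distrib, mul_add, Finset.sum_add_distrib]
    have e1 : ∑ a : κ, ∑ _b : κ, c₀ * (u a k * u a l) = c₀ * Fintype.card κ * S := by
      have : ∀ a, ∑ _b : κ, c₀ * (u a k * u a l) = (Fintype.card κ : ℝ) * (c₀ * (u a k * u a l)) :=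
        fun a ↦ by rw [Finset.sum_const, Finset.card_univ, nsmul_eq_mul]
      simp_rw [this, ← Finset.mul_sum, hS]
      ring
    have e2 : ∑ _a : κ, ∑ b : κ, c₀ * (u b k * u b l) = c₀ * Fintype.card κ * S := by
      rw [Finset.sum_const, Finset.card_univ, nsmul_eq_mul, ← Finset.mul_sum, hS]
      ring
    have e3 : ∑ a, ∑ b, B a b / 2 * (u b k * u a l) = ∑ a, ∑ b, B a b / 2 * (u a k * u b l) := by
      rw [Finset.sum_comm]
      refine Finset.sum_congr rfl fun a _ ↦ Finset.sum_congr rfl fun b _ ↦ ?_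
      rw [hB b a]
    have e4 : ∑ a, ∑ b, B a b / 2 * (u a k * u b l) + ∑ a, ∑ b, B a b / 2 * (u b k * u a l) =
        ∑ a, ∑ b, B a b * (u a k * u b l) := by
      rw [e3, ← Finset.sum_add_distrib]
      refine Finset.sum_congr rfl fun a _ ↦ ?_
      rw [← Finset.sum_add_distrib]
      refine Finset.sum_congr rfl fun b _ ↦ by ring
    rw [e1, e2, ← e4]
    ring
  -- `∑_a F a a = 2 c₀ S + ∑_a B_{aa} u_a(k) u_a(l)`
  have hdiagF : ∑ a, F a a = 2 * c₀ * S + ∑ a, B a a * (u a k * u a l) := by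
    simp_rw [hFaa, Finset.sum_add_distrib, ← Finset.mul_sum, hS]
  -- the `ite`-sum is the full sum minus the diagonal
  have hite : ∑ a, ∑ b, (if a = b then 0 else F a b) = ∑ a, ∑ b, F a b - ∑ a, F a a := by
    have : ∀ a, ∑ b, (if a = b then 0 else F a b) = ∑ b, F a b - F a a := by
      intro a
      have h1 : ∑ b, (if a = b then 0 else F a b) = ∑ b, (F a b - if a = b then F a b else 0) := by
        refine Finset.sum_congr rfl fun b _ ↦ ?_
        split_ifs <;> ring
      rw [h1, Finset.sum_sub_distrib, Finset.sum_ite_eq, if_pos (Finset.mem_univ a)]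
    simp_rw [this, Finset.sum_sub_distrib]
  have hdiag : ∑ a, (B a a - 2 * c₀ * (Fintype.card κ - 1)) * (u a k * u a l) =
      ∑ a, B a a * (u a k * u a l) - 2 * c₀ * (Fintype.card κ - 1) * S := by
    simp_rw [sub_mul, Finset.sum_sub_distrib, ← Finset.mul_sum, hS]
  change (∑ a, (B a a - 2 * c₀ * (Fintype.card κ - 1)) * (u a k * u a l)) +
    ∑ a, ∑ b, (if a = b then 0 else F a b) = ∑ a, ∑ b, B a b * (u a k * u b l)
  rw [hite, hsumF, hdiagF, hdiag]
  ring

/-! ### Orthonormal eigenbases of real symmetric positive definite matrices -/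

omit [DecidableEq κ] in
/-- A real symmetric matrix with `∑ₖₗ aₖₗ vₖ vₗ > 0` for `v ≠ 0` is positive definite in
Mathlib's sense. [folklore] -/
theorem posDef_of_forall_sum_pos {A₀ : κ → κ → ℝ} (hsymm : ∀ k l, A₀ k l = A₀ l k)
    (hpos : ∀ v : κ → ℝ, v ≠ 0 → 0 < ∑ k, ∑ l, A₀ k l * (v k * v l)) :
    (Matrix.of fun k l ↦ A₀ k l).PosDef := by
  refine PosDef.of_dotProduct_mulVec_pos (IsHermitian.ext fun i j ↦ by simp [hsymm i j]) ?_
  intro x hx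
  have h : star x ⬝ᵥ ((Matrix.of fun k l ↦ A₀ k l) *ᵥ x) = ∑ k, ∑ l, A₀ k l * (x k * x l) := by
    simp only [dotProduct, mulVec, star_trivial, Matrix.of_apply, Finset.mul_sum]
    refine Finset.sum_congr rfl fun k _ ↦ Finset.sum_congr rfl fun l _ ↦ by ring
  rw [h]
  exact hpos x hx

/-- **Orthonormal eigenbasis data of a real symmetric positive definite matrix**: rows `u_a`
with `∑ₖ u_a(k) u_b(k) = δ_{ab}` (orthonormality), `∑_a u_a(k) u_a(l) = δ_{kl}` (completeness),
`∑ₗ A₀(k,l) u_a(l) = λ_a u_a(k)` and `λ_a > 0` (the spectral theorem,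
`Matrix.IsHermitian.eigenvectorBasis`). [folklore] -/
theorem exists_orthonormal_eigen_rows {A₀ : κ → κ → ℝ} (hsymm : ∀ k l, A₀ k l = A₀ l k)
    (hpos : ∀ v : κ → ℝ, v ≠ 0 → 0 < ∑ k, ∑ l, A₀ k l * (v k * v l)) :
    ∃ (u : κ → κ → ℝ) (lam : κ → ℝ), (∀ a, 0 < lam a) ∧
      (∀ a b, ∑ k, u a k * u b k = if a = b then 1 else 0) ∧
      (∀ k l, ∑ a, u a k * u a l = if k = l then 1 else 0) ∧
      (∀ a k, ∑ l, A₀ k l * u a l = lam a * u a k) := by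
  have hP := posDef_of_forall_sum_pos hsymm hpos
  set hH : (Matrix.of fun k l ↦ A₀ k l).IsHermitian := hP.1
  set bas := hH.eigenvectorBasis with hbas
  refine ⟨fun a k ↦ bas a k, hH.eigenvalues, fun a ↦ hP.eigenvalues_pos a, ?_, ?_, ?_⟩
  · -- orthonormality
    intro a b
    have h := orthonormal_iff_ite.mp bas.orthonormal a b
    rw [EuclideanSpace.inner_eq_star_dotProduct] at h
    simpa [dotProduct, mul_comm] using h
  · -- completeness, from `∑ a ⟪u_a, e_l⟫ u_a = e_l`
    intro k l
    have h := bas.sum_repr' (EuclideanSpace.single l (1 : ℝ))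
    have h' := congrArg (fun v : EuclideanSpace ℝ κ ↦ v k) h
    simp only [EuclideanSpace.inner_single_right, one_mul, RCLike.conj_to_real,
      WithLp.ofLp_sum, Finset.sum_apply, WithLp.ofLp_smul, Pi.smul_apply, smul_eq_mul] at h'
    rw [show (EuclideanSpace.single l (1 : ℝ)) k = if k = l then 1 else 0 from
      PiLp.single_apply 2 ℝ l 1 k] at h'
    rw [← h']
    exact Finset.sum_congr rfl fun a _ ↦ by ring
  · -- the eigenvector equation
    intro a k
    have h := hH.mulVec_eigenvectorBasis a
    have h' := congrFun h k
    simp only [mulVec, dotProduct, Matrix.of_apply, Pi.smul_apply, smul_eq_mul] at h'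
    simpa [hbas] using h'

/-! ### The smooth sum-of-squares decomposition -/

variable {X : Type*} [NormedAddCommGroup X] [NormedSpace ℝ X]

/-- **Smooth sum-of-squares decomposition near a positive definite matrix.** Let
`A₀ = (aₖₗ)` be real, symmetric and positive definite. There are `δ > 0` and constant vectors
`wⱼ : κ → ℝ`, `j ∈ κ ⊕ (κ × κ × Bool)`, the first family `(w_{inl a})_a` spanning `κ → ℝ`,
such that: every smooth symmetric matrix-valued function `A(p)` on a real normed space which
is entrywise `δ`-close to `A₀` everywhere is `A(p)ₖₗ = ∑ⱼ gⱼ(p)² wⱼ(k) wⱼ(l)` with smooth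
real functions `gⱼ`, those of the first family being everywhere positive. (Spectral theorem for
`A₀` and the identity `sos_sum_identity` with `c₀ = λ_min/(2n)`; the coefficients are affine in
the entries of `A(p)`, positive or identically zero, and `gⱼ = √·`.) This puts the principal part
`∑ₖₗ A(p)ₖₗ ∂ₖ∂ₗ` of a variable-coefficient operator in Hörmander's form `∑ⱼ Yⱼ²`,
`Yⱼ = gⱼ wⱼ` (Hörmander 1967, (1.6)). [cite: Hormander1967, eq. (1.6) and Thm 1.1] -/
theorem exists_smooth_sumOfSquares {A₀ : κ → κ → ℝ} (hsymm : ∀ k l, A₀ k l = A₀ l k)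
    (hpos : ∀ v : κ → ℝ, v ≠ 0 → 0 < ∑ k, ∑ l, A₀ k l * (v k * v l)) :
    ∃ δ : ℝ, 0 < δ ∧ ∃ w : κ ⊕ (κ × κ × Bool) → κ → ℝ,
      (∀ v : κ → ℝ, v ∈ Submodule.span ℝ (Set.range fun a : κ ↦ w (Sum.inl a))) ∧
      ∀ (A : κ → κ → X → ℝ), (∀ k l, ContDiff ℝ ∞ (A k l)) → (∀ k l p, A k l p = A l k p) →
        (∀ k l p, |A k l p - A₀ k l| ≤ δ) →
        ∃ g : κ ⊕ (κ × κ × Bool) → X → ℝ, (∀ j, ContDiff ℝ ∞ (g j)) ∧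
          (∀ (a : κ) (p : X), 0 < g (Sum.inl a) p) ∧
          ∀ p k l, A k l p = ∑ j, g j p ^ 2 * (w j k * w j l) := by
  classical
  obtain ⟨u, lam, hlam, hon, hcomp, heig⟩ := exists_orthonormal_eigen_rows hsymm hpos
  -- the vectors
  set w : κ ⊕ (κ × κ × Bool) → κ → ℝ := fun j ↦ match j with
    | Sum.inl a => u a
    | Sum.inr (a, b, true) => fun k ↦ u a k + u b k
    | Sum.inr (a, b, false) => fun k ↦ u a k - u b k with hw
  have hspan : ∀ v : κ → ℝ, v ∈ Submodule.span ℝ (Set.range fun a : κ ↦ w (Sum.inl a)) := by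
    intro v
    have hv : v = ∑ a, (∑ l, v l * u a l) • u a := by
      funext k
      simp only [Finset.sum_apply, Pi.smul_apply, smul_eq_mul]
      have : ∀ a, (∑ l, v l * u a l) * u a k = ∑ l, v l * (u a l * u a k) := fun a ↦ by
        rw [Finset.sum_mul]; exact Finset.sum_congr rfl fun l _ ↦ by ring
      simp_rw [this]
      rw [Finset.sum_comm]
      simp_rw [← Finset.mul_sum, hcomp, mul_ite, mul_one, mul_zero]
      rw [Finset.sum_ite_eq' Finset.univ k, if_pos (Finset.mem_univ k)]
    rw [hv]
    exact Submodule.sum_mem _ fun a _ ↦ Submodule.smul_mem _ _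
      (Submodule.subset_span ⟨a, rfl⟩)
  -- empty index type: everything is vacuous
  rcases isEmpty_or_nonempty κ with hκ | hκ
  · refine ⟨1, one_pos, w, hspan, fun A hA hAs hcl ↦ ⟨fun _ _ ↦ 1, fun _ ↦ contDiff_const,
      fun a ↦ (IsEmpty.false a).elim, fun p k ↦ (IsEmpty.false k).elim⟩⟩
  -- constants
  obtain ⟨a₀, -, ha₀⟩ := Finset.exists_min_image Finset.univ lam Finset.univ_nonempty
  set lmin : ℝ := lam a₀ with hlmin
  have hlmin_pos : 0 < lmin := hlam a₀
  have hlmin_le : ∀ a, lmin ≤ lam a := fun a ↦ ha₀ a (Finset.mem_univ a)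
  set n : ℕ := Fintype.card κ with hn
  have hn1 : (1 : ℝ) ≤ n := by exact_mod_cast Fintype.card_pos
  have hn0 : (0 : ℝ) < n := by linarith
  set c₀ : ℝ := lmin / (2 * n) with hc₀
  set ε : ℝ := lmin / (2 * n) with hε
  have hε0 : 0 < ε := by positivity
  set δ : ℝ := ε / (n ^ 2 + 1) with hδ
  have hδ0 : 0 < δ := by positivity
  have hu1 : ∀ a k, |u a k| ≤ 1 := by
    intro a k
    have h := hon a a
    rw [if_pos rfl] at h
    have hk : u a k * u a k ≤ ∑ k', u a k' * u a k' :=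
      Finset.single_le_sum (f := fun k' ↦ u a k' * u a k') (fun k' _ ↦ mul_self_nonneg _)
        (Finset.mem_univ k)
    rw [h] at hk
    exact abs_le_one_iff_mul_self_le_one.mpr hk
  refine ⟨δ, hδ0, w, hspan, fun A hA hAs hcl ↦ ?_⟩
  -- the coefficients `B_{ab}(p) = u_aᵀ A(p) u_b`
  set B : κ → κ → X → ℝ := fun a b p ↦ ∑ k, ∑ l, u a k * A k l p * u b l with hBdef
  have hBs : ∀ a b, ContDiff ℝ ∞ (B a b) := fun a b ↦
    ContDiff.sum fun k _ ↦ ContDiff.sum fun l _ ↦ (contDiff_const.mul (hA k l)).mul contDiff_const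
  have hBsymm : ∀ a b p, B a b p = B b a p := by
    intro a b p
    simp only [hBdef]
    rw [Finset.sum_comm]
    refine Finset.sum_congr rfl fun k _ ↦ Finset.sum_congr rfl fun l _ ↦ ?_
    rw [hAs l k]; ring
  -- `B_{ab}` at `A₀` is `λ_b δ_{ab}`, and `B_{ab}(p)` is `ε`-close to it
  have hB0 : ∀ a b, ∑ k, ∑ l, u a k * A₀ k l * u b l = if a = b then lam a else 0 := by
    intro a b
    have : ∀ k, ∑ l, u a k * A₀ k l * u b l = u a k * (lam b * u b k) := by
      intro k
      rw [← heig b k, Finset.mul_sum]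
      exact Finset.sum_congr rfl fun l _ ↦ by ring
    simp_rw [this]
    have h2 : ∑ k, u a k * (lam b * u b k) = lam b * ∑ k, u a k * u b k := by
      rw [Finset.mul_sum]; exact Finset.sum_congr rfl fun k _ ↦ by ring
    rw [h2, hon a b]
    split_ifs with h
    · subst h; ring
    · ring
  have hBclose : ∀ a b p, |B a b p - (if a = b then lam a else 0)| ≤ ε := by
    intro a b p
    rw [← hB0 a b]
    simp only [hBdef]
    rw [← Finset.sum_sub_distrib]
    calc |∑ k, (∑ l, u a k * A k l p * u b l - ∑ l, u a k * A₀ k l * u b l)|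
        ≤ ∑ k, |∑ l, u a k * A k l p * u b l - ∑ l, u a k * A₀ k l * u b l| :=
          Finset.abs_sum_le_sum_abs _ _
      _ ≤ ∑ k, ∑ l, δ := by
          refine Finset.sum_le_sum fun k _ ↦ ?_
          rw [← Finset.sum_sub_distrib]
          refine (Finset.abs_sum_le_sum_abs _ _).trans (Finset.sum_le_sum fun l _ ↦ ?_)
          rw [show u a k * A k l p * u b l - u a k * A₀ k l * u b l =
            u a k * (A k l p - A₀ k l) * u b l by ring, abs_mul, abs_mul]
          calc |u a k| * |A k l p - A₀ k l| * |u b l| ≤ 1 * δ * 1 :=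
                mul_le_mul (mul_le_mul (hu1 a k) (hcl k l p) (abs_nonneg _) zero_le_one)
                  (hu1 b l) (abs_nonneg _) (by positivity)
            _ = δ := by ring
      _ = n ^ 2 * δ := by
          simp only [Finset.sum_const, Finset.card_univ, nsmul_eq_mul, ← hn]; ring
      _ ≤ ε := by
          rw [hδ, show (n : ℝ) ^ 2 * (ε / (n ^ 2 + 1)) = ε * (n ^ 2 / (n ^ 2 + 1)) by ring]
          have : (n : ℝ) ^ 2 / (n ^ 2 + 1) ≤ 1 := by
            rw [div_le_one (by positivity)]; linarith
          nlinarith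
  -- the coefficient functions
  set c : κ ⊕ (κ × κ × Bool) → X → ℝ := fun j p ↦ match j with
    | Sum.inl a => B a a p - 2 * c₀ * (n - 1)
    | Sum.inr (a, b, true) => if a = b then 0 else (c₀ + B a b p / 2) / 2
    | Sum.inr (a, b, false) => if a = b then 0 else (c₀ - B a b p / 2) / 2 with hc
  have hdiag_pos : ∀ a p, 0 < B a a p - 2 * c₀ * (n - 1) := by
    intro a p
    have h1 := hBclose a a p
    rw [if_pos rfl] at h1
    have h2 : lam a - ε ≤ B a a p := by linarith [(abs_le.mp h1).1]
    have h3 : lmin ≤ lam a := hlmin_le a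
    have key : 2 * c₀ * (n - 1) + ε < lmin := by
      rw [hc₀, hε]
      have : 2 * (lmin / (2 * n)) * (n - 1) + lmin / (2 * n) = lmin - lmin / (2 * n) := by
        field_simp; ring
      rw [this]
      linarith [div_pos hlmin_pos (by positivity : (0 : ℝ) < 2 * n)]
    linarith
  have hpair_pos : ∀ a b p, a ≠ b → 0 < (c₀ + B a b p / 2) / 2 ∧ 0 < (c₀ - B a b p / 2) / 2 := by
    intro a b p hab
    have h1 := hBclose a b p
    rw [if_neg hab, sub_zero] at h1
    have h2 := abs_le.mp h1
    have key : ε / 2 < c₀ := by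
      rw [hc₀, hε]; linarith [div_pos hlmin_pos (by positivity : (0 : ℝ) < 2 * n)]
    constructor <;> linarith
  have hc_nonneg : ∀ j p, 0 ≤ c j p := by
    rintro (a | ⟨a, b, _ | _⟩) p
    · exact (hdiag_pos a p).le
    · change 0 ≤ if a = b then 0 else (c₀ - B a b p / 2) / 2
      split_ifs with h
      · exact le_rfl
      · exact (hpair_pos a b p h).2.le
    · change 0 ≤ if a = b then 0 else (c₀ + B a b p / 2) / 2
      split_ifs with h
      · exact le_rfl
      · exact (hpair_pos a b p h).1.le
  -- `g = √c` is smooth: each `c j` is either identically `0` or everywhere positive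
  set g : κ ⊕ (κ × κ × Bool) → X → ℝ := fun j p ↦ Real.sqrt (c j p) with hg
  have hgs : ∀ j, ContDiff ℝ ∞ (g j) := by
    rintro (a | ⟨a, b, bb⟩)
    · change ContDiff ℝ ∞ fun p ↦ Real.sqrt (B a a p - 2 * c₀ * (n - 1))
      exact ((hBs a a).sub contDiff_const).sqrt fun p ↦ (hdiag_pos a p).ne'
    · by_cases hab : a = b
      · have : g (Sum.inr (a, b, bb)) = fun _ ↦ 0 := by
          funext p; cases bb <;> simp [hg, hc, hab]
        rw [this]; exact contDiff_const
      · cases bb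
        · change ContDiff ℝ ∞ fun p ↦ Real.sqrt (if a = b then 0 else (c₀ - B a b p / 2) / 2)
          simp only [if_neg hab]
          exact ((contDiff_const.sub ((hBs a b).div_const 2)).div_const 2).sqrt
            fun p ↦ (hpair_pos a b p hab).2.ne'
        · change ContDiff ℝ ∞ fun p ↦ Real.sqrt (if a = b then 0 else (c₀ + B a b p / 2) / 2)
          simp only [if_neg hab]
          exact ((contDiff_const.add ((hBs a b).div_const 2)).div_const 2).sqrt
            fun p ↦ (hpair_pos a b p hab).1.ne'
  refine ⟨g, hgs, fun a p ↦ Real.sqrt_pos.mpr (hdiag_pos a p), fun p k l ↦ ?_⟩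
  -- the identity
  have hsq : ∀ j, g j p ^ 2 = c j p := fun j ↦ Real.sq_sqrt (hc_nonneg j p)
  simp_rw [hsq]
  rw [Fintype.sum_sum_type, Fintype.sum_prod_type, sos_expand_of_complete hcomp (fun k l ↦ A k l p) k l]
  simp_rw [Fintype.sum_prod_type, Fintype.sum_bool]
  have hmain := sos_sum_identity u (B := fun a b ↦ B a b p) (fun a b ↦ hBsymm a b p) c₀ k l
  rw [← hmain]
  congr 1
  refine Finset.sum_congr rfl fun a _ ↦ Finset.sum_congr rfl fun b _ ↦ ?_
  simp only [hc, hw]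
  split_ifs with h
  · ring
  · ring

end Literature.Analysis.Distribution
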